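import Mathlib
import Summits.Ventures.PercRepro.TriangleCapSecondBest

/-!
# PercRepro — THE BROOM: the second-best value on the bipartite class is attained, so it is EXACTLY the closed
form minus `2 (r − 2)` (p3, gen 42; part 186)

Part 184 bounds every spanning subgraph of `K_{a,k−a}` whose `r ≥ 3` missing cross pairs are not a star by
`Σ_v d(v)² ≤ m k − r (k − 1 − r) − 2 (r − 2)`.  The bound is attained: `K_{a,k−a}` minus a star of `r − 1` pairs
at the vertex `0` of the small side, minus one more pair `{1, a}` at a leaf `a` of the star (the BROOM).  It is
built as one edge deleted from `bipMinusStar k a (r − 1)` (`delEdge`, with its three counts: the degrees drop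
by one at the two ends, the edge count by one, `Σ d²` by `2 (d(x) + d(y)) − 2`), and its missing pairs
`{0, a+1}` and `{1, a}` are disjoint, so no vertex lies on all of them.  `second_best_bipSub_exact` states the
two halves together: on the bipartite class with the parts `a, k − a` the second-best value of the closed form
is exactly `m k − r (k − 1 − r) − 2 (r − 2)` for `r ≥ 3`.  Axioms: standard.
-/

namespace PercRepro

namespace TriangleCap

namespace C047

open Finset

variable {V : Type*} [Fintype V] [DecidableEq V]

/-- `D` minus the edge `x y`. -/
def delEdge (D : SimpleGraph V) (x y : V) : SimpleGraph V where
  Adj u w := D.Adj u w ∧ ¬ ((u = x ∧ w = y) ∨ (u = y ∧ w = x))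
  symm := ⟨fun u w h => by
    refine ⟨D.adj_symm h.1, ?_⟩
    rintro (⟨h1, h2⟩ | ⟨h1, h2⟩)
    · exact h.2 (Or.inr ⟨h2, h1⟩)
    · exact h.2 (Or.inl ⟨h2, h1⟩)⟩
  loopless := ⟨fun u h => D.irrefl h.1⟩

/-- Adjacency in `D` minus an edge is decidable. -/
instance decidableRelDelEdge (D : SimpleGraph V) [DecidableRel D.Adj] (x y : V) : DecidableRel (delEdge D x y).Adj :=
  fun u w => inferInstanceAs (Decidable (D.Adj u w ∧ ¬ ((u = x ∧ w = y) ∨ (u = y ∧ w = x))))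

omit [Fintype V] [DecidableEq V] in
/-- Adjacency in `D` minus an edge. -/
theorem delEdge_adj (D : SimpleGraph V) (x y u w : V) :
    (delEdge D x y).Adj u w ↔ D.Adj u w ∧ ¬ ((u = x ∧ w = y) ∨ (u = y ∧ w = x)) := Iff.rfl

omit [Fintype V] [DecidableEq V] in
/-- `D` minus an edge is a subgraph of `D`. -/
theorem delEdge_le (D : SimpleGraph V) (x y : V) : delEdge D x y ≤ D := fun _ _ h => h.1

/-- **THE DEGREES AFTER AN EDGE DELETION:** one less at `x` and at `y`, unchanged elsewhere. -/
theorem deg_delEdge (D : SimpleGraph V) [DecidableRel D.Adj] {x y : V} (hxy : D.Adj x y) (v : V) :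
    deg (delEdge D x y) v + (if v = x ∨ v = y then 1 else 0) = deg D v := by
  unfold deg
  by_cases hv : v = x ∨ v = y
  · rw [if_pos hv]
    -- the partner of `v` on the edge
    obtain ⟨p, hp, hpv⟩ : ∃ p, D.Adj v p ∧ ∀ w, (delEdge D x y).Adj v w ↔ D.Adj v w ∧ w ≠ p := by
      rcases hv with rfl | rfl
      · exact ⟨y, hxy, fun w => by
          rw [delEdge_adj]
          constructor
          · rintro ⟨h1, h2⟩
            exact ⟨h1, fun h => h2 (Or.inl ⟨rfl, h⟩)⟩
          · rintro ⟨h1, h2⟩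
            refine ⟨h1, ?_⟩
            rintro (⟨-, h⟩ | ⟨h, -⟩)
            · exact h2 h
            · exact D.ne_of_adj hxy h⟩
      · exact ⟨x, D.adj_symm hxy, fun w => by
          rw [delEdge_adj]
          constructor
          · rintro ⟨h1, h2⟩
            exact ⟨h1, fun h => h2 (Or.inr ⟨rfl, h⟩)⟩
          · rintro ⟨h1, h2⟩
            refine ⟨h1, ?_⟩
            rintro (⟨h, -⟩ | ⟨-, h⟩)
            · exact D.ne_of_adj hxy h.symm
            · exact h2 h⟩
    have heq : univ.filter (fun w => (delEdge D x y).Adj v w) = (univ.filter (fun w => D.Adj v w)).erase p := by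
      ext w
      rw [mem_filter, mem_erase, mem_filter, hpv w]
      tauto
    rw [heq, card_erase_of_mem (mem_filter.mpr ⟨mem_univ p, hp⟩)]
    have : 1 ≤ (univ.filter (fun w => D.Adj v w)).card := card_pos.mpr ⟨p, mem_filter.mpr ⟨mem_univ p, hp⟩⟩
    exact Nat.sub_add_cancel this
  · rw [if_neg hv, add_zero]
    congr 1
    ext w
    rw [mem_filter, mem_filter, delEdge_adj]
    push Not at hv
    constructor
    · rintro ⟨h1, h2, -⟩
      exact ⟨h1, h2⟩
    · rintro ⟨h1, h2⟩
      refine ⟨h1, h2, ?_⟩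
      rintro (⟨h, -⟩ | ⟨h, -⟩)
      · exact hv.1 h
      · exact hv.2 h

/-- **THE EDGE COUNT AFTER AN EDGE DELETION:** one less. -/
theorem card_edges_delEdge (D : SimpleGraph V) [DecidableRel D.Adj] {x y : V} (hxy : D.Adj x y) :
    (delEdge D x y).edgeFinset.card + 1 = D.edgeFinset.card := by
  have h1 := sum_deg_eq D
  have h2 := sum_deg_eq (delEdge D x y)
  have h3 : ∑ v, (deg (delEdge D x y) v + (if v = x ∨ v = y then 1 else 0)) = ∑ v, deg D v :=
    sum_congr rfl (fun v _ => deg_delEdge D hxy v)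
  rw [sum_add_distrib] at h3
  have h4 : ∑ v, (if v = x ∨ v = y then 1 else 0) = 2 := by
    rw [← card_filter]
    have : univ.filter (fun v => v = x ∨ v = y) = {x, y} := by
      ext v
      simp only [mem_filter, mem_univ, true_and, mem_insert, mem_singleton]
    rw [this, card_pair (D.ne_of_adj hxy)]
  omega

/-- **THE DEGREE SQUARES AFTER AN EDGE DELETION:** `Σ d'² + 2 (d(x) + d(y)) = Σ d² + 2`. -/
theorem sum_deg_sq_delEdge (D : SimpleGraph V) [DecidableRel D.Adj] {x y : V} (hxy : D.Adj x y) :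
    ∑ v, deg (delEdge D x y) v * deg (delEdge D x y) v + 2 * (deg D x + deg D y) =
      ∑ v, deg D v * deg D v + 2 := by
  have hne : x ≠ y := D.ne_of_adj hxy
  have hx := deg_delEdge D hxy x
  have hy := deg_delEdge D hxy y
  rw [if_pos (Or.inl rfl)] at hx
  rw [if_pos (Or.inr rfl)] at hy
  have hother : ∀ v, v ≠ x → v ≠ y → deg (delEdge D x y) v = deg D v := by
    intro v h1 h2
    have := deg_delEdge D hxy v
    rw [if_neg (by tauto), add_zero] at this
    exact this
  have hyx : y ∈ (univ : Finset V).erase x := mem_erase.mpr ⟨hne.symm, mem_univ y⟩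
  rw [← add_sum_erase univ _ (mem_univ x), ← add_sum_erase (univ.erase x) _ hyx,
    ← add_sum_erase univ (fun v => deg D v * deg D v) (mem_univ x),
    ← add_sum_erase (univ.erase x) (fun v => deg D v * deg D v) hyx]
  have hrest : ∑ v ∈ (univ.erase x).erase y, deg (delEdge D x y) v * deg (delEdge D x y) v =
      ∑ v ∈ (univ.erase x).erase y, deg D v * deg D v := by
    apply sum_congr rfl
    intro v hv
    rw [mem_erase, mem_erase] at hv
    rw [hother v hv.2.1 hv.1]
  rw [hrest]
  have hdx : deg (delEdge D x y) x = deg D x - 1 := by omega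
  have hdy : deg (delEdge D x y) y = deg D y - 1 := by omega
  rw [hdx, hdy]
  have h1 : 1 ≤ deg D x := by omega
  have h2 : 1 ≤ deg D y := by omega
  obtain ⟨dx, hdx'⟩ : ∃ dx, deg D x = dx + 1 := ⟨deg D x - 1, by omega⟩
  obtain ⟨dy, hdy'⟩ : ∃ dy, deg D y = dy + 1 := ⟨deg D y - 1, by omega⟩
  rw [hdx', hdy', Nat.add_sub_cancel, Nat.add_sub_cancel]
  ring

/-- **THE BROOM** on `Fin n`: `K_{a,n−a}` minus a star of `r − 1` pairs at the vertex `0` (`bipMinusStar n a (r − 1)`)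
minus the pair `{1, a}` at the leaf `a` of the star. -/
abbrev broom (n a r : ℕ) (h1 : 1 < n) (ha : a < n) : SimpleGraph (Fin n) :=
  delEdge (bipMinusStar n a (r - 1)) ⟨1, h1⟩ ⟨a, ha⟩

/-- The pair `{1, a}` is an edge of `K_{a,n−a}` minus the star at `0` (for `2 ≤ a`). -/
theorem bipMinusStar_adj_one_a (n a r : ℕ) (h1 : 1 < n) (ha : a < n) (ha2 : 2 ≤ a) :
    (bipMinusStar n a (r - 1)).Adj ⟨1, h1⟩ ⟨a, ha⟩ := by
  rw [bipMinusStar_adj]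
  refine ⟨Or.inl ⟨by show 1 < a; omega, by show ¬ (a < a); omega⟩, ?_⟩
  rintro (⟨h, -⟩ | ⟨h, -⟩)
  · exact absurd h (by show (1 : ℕ) ≠ 0; omega)
  · exact absurd h (by show a ≠ 0; omega)

/-- **THE BROOM ATTAINS THE SECOND-BEST VALUE:** for `2 ≤ a`, `3 ≤ r`, `a + r ≤ n + 1`, the broom is `K₄⁻`-free, a
spanning subgraph of `K(A, Aᶜ)` with `|A| = a` whose missing pairs are not a star, with `a(n−a) − r` edges and
`Σ_v d(v)² + r (n − 1 − r) + 2 (r − 2) = m n`. -/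
theorem broom_value (n a r : ℕ) (ha2 : 2 ≤ a) (hr3 : 3 ≤ r) (han : a + r ≤ n + 1) :
    ∃ (D : SimpleGraph (Fin n)) (_ : DecidableRel D.Adj) (A : Finset (Fin n)), K4mFree D ∧ A.card = a ∧
      BipSub D A ∧ (¬ ∃ v, MissingStar D A v) ∧ D.edgeFinset.card = a * (n - a) - r ∧
      ∑ v, deg D v * deg D v + r * (n - 1 - r) + 2 * (r - 2) = (a * (n - a) - r) * n := by
  have h1 : 1 < n := by omega
  have ha : a < n := by omega
  have hadj := bipMinusStar_adj_one_a n a r h1 ha ha2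
  refine ⟨broom n a r h1 ha, inferInstance, univ.filter (fun i : Fin n => i.val < a), ?_, ?_, ?_, ?_, ?_, ?_⟩
  · exact k4mFree_of_le _ _ (delEdge_le _ _ _) (k4mFree_bipMinusStar n a (r - 1))
  · exact card_left n a (by omega)
  · intro u w huw
    have huw' := (delEdge_le _ _ _ huw)
    have := (bipMinusStar_le_bip n a (r - 1)) huw'
    rw [bip_adj] at this
    simp only [mem_filter, mem_univ, true_and]
    rcases this with ⟨h1, h2⟩ | ⟨h1, h2⟩
    · exact ⟨fun _ => h2, fun _ => h1⟩
    · exact ⟨fun h => absurd h h2, fun h => absurd h1 h⟩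
  · -- the missing pairs `{0, a+1}` and `{1, a}` are disjoint
    rintro ⟨v, hv⟩
    have hm1 : ¬ (broom n a r h1 ha).Adj ⟨0, by omega⟩ ⟨a + 1, by omega⟩ := by
      intro h
      have := (delEdge_le _ _ _ h)
      rw [bipMinusStar_adj] at this
      obtain ⟨-, h2⟩ := this
      exact h2 (Or.inl ⟨rfl, Nat.le_succ a, by show a + 1 < a + (r - 1); omega⟩)
    have hm2 : ¬ (broom n a r h1 ha).Adj ⟨1, h1⟩ ⟨a, ha⟩ := by
      intro h
      have h' : (delEdge (bipMinusStar n a (r - 1)) ⟨1, h1⟩ ⟨a, ha⟩).Adj ⟨1, h1⟩ ⟨a, ha⟩ := h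
      rw [delEdge_adj] at h'
      exact h'.2 (Or.inl ⟨rfl, rfl⟩)
    have e1 := hv ⟨0, by omega⟩ ⟨a + 1, by omega⟩ (mem_filter.mpr ⟨mem_univ _, by show 0 < a; omega⟩)
      (fun h => by have := (mem_filter.mp h).2; change a + 1 < a at this; omega) hm1
    have e2 := hv ⟨1, h1⟩ ⟨a, ha⟩ (mem_filter.mpr ⟨mem_univ _, by show 1 < a; omega⟩)
      (fun h => by have := (mem_filter.mp h).2; change a < a at this; omega) hm2
    rcases e1 with e1 | e1 <;> rcases e2 with e2 | e2 <;>
      · have := Fin.mk.inj_iff.mp (e1.trans e2.symm)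
        omega
  · have h2 := card_edges_delEdge (bipMinusStar n a (r - 1)) hadj
    have h3 := card_edges_bipMinusStar n a (r - 1) (by omega) (by omega)
    show (delEdge (bipMinusStar n a (r - 1)) ⟨1, h1⟩ ⟨a, ha⟩).edgeFinset.card = a * (n - a) - r
    generalize hP : a * (n - a) = P at h3 ⊢
    have : (delEdge (bipMinusStar n a (r - 1)) ⟨1, h1⟩ ⟨a, ha⟩).edgeFinset.card + r = P := by omega
    exact Nat.eq_sub_of_add_eq this
  · have h2 := sum_deg_sq_delEdge (bipMinusStar n a (r - 1)) hadj
    have h3 := two_mul_cherries_bipMinusStar n a (r - 1) (by omega) (by omega) (by omega)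
    have h4 := two_mul_cherries_add (bipMinusStar n a (r - 1))
    have h5 := sum_deg_eq (bipMinusStar n a (r - 1))
    have h6 := card_edges_bipMinusStar n a (r - 1) (by omega) (by omega)
    have hE := card_edges_delEdge (bipMinusStar n a (r - 1)) hadj
    -- the degrees of the two ends in `bipMinusStar`
    have hd1 : deg (bipMinusStar n a (r - 1)) ⟨1, h1⟩ = n - a := by
      rw [deg_bipMinusStar n a (r - 1) (by omega) (by omega)]
      rw [if_neg (by show (1 : ℕ) ≠ 0; omega), if_neg (by
        unfold rightStar
        simp only [mem_filter, mem_univ, true_and]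
        show ¬ (a ≤ 1 ∧ 1 < a + (r - 1))
        omega)]
      exact deg_bip_of_lt n a (by omega) ⟨1, h1⟩ (by show 1 < a; omega)
    have hda : deg (bipMinusStar n a (r - 1)) ⟨a, ha⟩ = a - 1 := by
      rw [deg_bipMinusStar n a (r - 1) (by omega) (by omega)]
      rw [if_neg (by show a ≠ 0; omega), if_pos (by
        unfold rightStar
        simp only [mem_filter, mem_univ, true_and]
        show a ≤ a ∧ a < a + (r - 1)
        omega)]
    rw [hd1, hda] at h2
    show ∑ v, deg (delEdge (bipMinusStar n a (r - 1)) ⟨1, h1⟩ ⟨a, ha⟩) v *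
        deg (delEdge (bipMinusStar n a (r - 1)) ⟨1, h1⟩ ⟨a, ha⟩) v + r * (n - 1 - r) + 2 * (r - 2) =
      (a * (n - a) - r) * n
    generalize hS : ∑ v, deg (delEdge (bipMinusStar n a (r - 1)) ⟨1, h1⟩ ⟨a, ha⟩) v *
      deg (delEdge (bipMinusStar n a (r - 1)) ⟨1, h1⟩ ⟨a, ha⟩) v = S at h2 ⊢
    generalize hS' : ∑ v, deg (bipMinusStar n a (r - 1)) v * deg (bipMinusStar n a (r - 1)) v = S' at h2 h4
    generalize hC : cherries (bipMinusStar n a (r - 1)) = C at h3 h4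
    generalize hM : (bipMinusStar n a (r - 1)).edgeFinset.card = M at h4 h5 h6 hE
    generalize hM' : (delEdge (bipMinusStar n a (r - 1)) ⟨1, h1⟩ ⟨a, ha⟩).edgeFinset.card = M' at hE
    rw [h5] at h4
    obtain ⟨a₂, rfl⟩ : ∃ a₂, a = a₂ + 2 := ⟨a - 2, by omega⟩
    obtain ⟨r₂, rfl⟩ : ∃ r₂, r = r₂ + 3 := ⟨r - 3, by omega⟩
    obtain ⟨c, rfl⟩ : ∃ c, n = a₂ + 2 + (r₂ + 2) + c := ⟨n - (a₂ + 2 + (r₂ + 2)), by omega⟩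
    have e1 : a₂ + 2 + (r₂ + 2) + c - (a₂ + 2) = r₂ + 2 + c := by omega
    have e2 : r₂ + 3 - 1 = r₂ + 2 := by omega
    have e3 : a₂ + 2 - 1 = a₂ + 1 := by omega
    have e4 : 2 * (a₂ + 2 + (r₂ + 2) + c) - (r₂ + 2) - 3 = 2 * a₂ + r₂ + 2 * c + 3 := by omega
    have e5 : a₂ + 2 + (r₂ + 2) + c - 2 = a₂ + r₂ + 2 + c := by omega
    have e6 : a₂ + 2 + (r₂ + 2) + c - 1 - (r₂ + 3) = a₂ + c := by omega
    have e7 : r₂ + 3 - 2 = r₂ + 1 := by omega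
    rw [e1, e3] at h2
    rw [e1, e2, e5, e4] at h3
    rw [e1, e2] at h6
    rw [e1, e6, e7]
    have hMr : (a₂ + 2) * (r₂ + 2 + c) - (r₂ + 3) = M' := by omega
    rw [hMr]
    zify at h2 h3 h4 h6 hE ⊢
    linear_combination h2 + h3 - h4 + (2 - (a₂ + 2 + (r₂ + 2) + (c : ℤ))) * h6 - (a₂ + 2 + (r₂ + 2) + (c : ℤ)) * hE

/-- **THE SECOND-BEST VALUE ON THE BIPARTITE CLASS IS EXACT:** for `2 ≤ a`, `3 ≤ r`, `a + r ≤ n + 1`, every spanning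
subgraph of a `K(A, Aᶜ)` with `|A| = a` on `Fin n` whose `r` missing pairs are not a star has
`Σ_v d(v)² + r (n − 1 − r) + 2 (r − 2) ≤ m n`, and the broom attains it. -/
theorem second_best_bipSub_exact (n a r : ℕ) (ha2 : 2 ≤ a) (hr3 : 3 ≤ r) (han : a + r ≤ n + 1) :
    (∀ (D : SimpleGraph (Fin n)) [DecidableRel D.Adj] (A : Finset (Fin n)), BipSub D A → A.card = a →
      D.edgeFinset.card + r = a * (n - a) → (¬ ∃ v, MissingStar D A v) →
      ∑ v, deg D v * deg D v + r * (n - 1 - r) + 2 * (r - 2) ≤ D.edgeFinset.card * n) ∧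
    ∃ (D : SimpleGraph (Fin n)) (_ : DecidableRel D.Adj) (A : Finset (Fin n)), K4mFree D ∧ A.card = a ∧
      BipSub D A ∧ (¬ ∃ v, MissingStar D A v) ∧ D.edgeFinset.card = a * (n - a) - r ∧
      ∑ v, deg D v * deg D v + r * (n - 1 - r) + 2 * (r - 2) = (a * (n - a) - r) * n := by
  constructor
  · intro D _ A hsub hA hm hns
    have := closed_form_stability_bipSub D A hsub a r hA (by rw [Fintype.card_fin]; exact hm)
      (by rw [Fintype.card_fin]; omega) (by omega) hns
    rwa [Fintype.card_fin] at this
  · exact broom_value n a r ha2 hr3 han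

end C047

end TriangleCap

end PercRepro
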